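import Literature.NumberTheory.DiophantineGeometry.FaltingsHeight
import HarnessLib

/-!
# Gaudron–Rémond 2023 for a pair of elliptic curves: torsion-sharing primes are bounded by the
# Faltings heights (Thm. 1.5 (1) + Thm. 1.8 at the reference variety `E × E'`)

Cite item `wi-09532` (route ABC/IsogenyGlueCongruence: the known case `κ(d) = 2 + 2d`, `d = 1`,
of crux K1 `TorsionSharingPrimeBound`, i.e. the height form behind support item
`PolyFreyMazurPairs`). Source read this session (held, `paper:doi-10-24033-msmf-484`):
É. Gaudron, G. Rémond, *Nouveaux théorèmes d'isogénie*, Mém. SMF 176 (2023), Ch. 1, verbatim: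

* §1.2 (p. 10): `K` a field of characteristic `0`, `C` a non-zero abelian variety over `K`,
  "`C` is isogenous to `C₁^{q₁} × ⋯ × C_t^{q_t}`" (`Cᵢ` simple, pairwise non-isogenous — everything
  over `K`: "`End A` est bien formé uniquement des morphismes `A → A` au-dessus de `Spec K`", "`A`
  et `B` sont dites isogènes si [`Hom(A,B)`] contient une isogénie") "et `𝒞` est alors l'ensemble
  de toutes les variétés abéliennes isogènes à l'un des produits `C₁^{m₁} × ⋯ × C_t^{m_t}`",
  `mᵢ ∈ ℕ`; "`n = Σᵢ 2(dim Cᵢ)²/rg End Cᵢ`"; Notation 1.1: `d = max{disc(End A) | A ∈ 𝒞₀,#}`;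
  Notation 1.2: `Υ`, with "`Υ² ≤ d ≤ Υ^{2n}`".
* p. 13: "nous disons qu'un entier naturel divise `d^{1/2}` si son carré divise l'entier `d`".
  **Théorème 1.5.** "Soit `A` une variété abélienne dans `𝒞`. (1) Pour toute variété abélienne
  `B` de `𝒞` et tout entier `m ≥ 1` l'exposant du conoyau de l'application naturelle
  `Hom(A, B) → Hom_{Gal(K̄/K)}(A[m], B[m])` divise `d^{1/2}`."
* §1.5 (p. 15, `K` a number field, `h_F` the stable Faltings height "avec la normalisation
  initiale de Faltings"): **Théorème 1.8.** "`Υ ≤ 241 (e n)^{2n} n⁵ [K:ℚ] max(1, log [K:ℚ],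
  h_F(C) + (3/2) dim C)`" (`e = exp 1`: the proof, Ch. 16, expands `log (en)^{2n} = 2n(1 + log n)`).

## The vendored special case and its derivation (why it is implied by the printed theorems)

Take `C = E × E'` for elliptic curves `E`, `E'` over the number field `K` that are NOT isogenous
over `K`. Then `t = 2`, `C₁ = E`, `C₂ = E'`, and `A = E`, `B = E'` lie in `𝒞`. Since
`Hom_K(E, E') = 0` (a non-zero homomorphism of elliptic curves is an isogeny), the cokernel in
Thm. 1.5 (1) is the whole group `Hom_{Gal}(E[ℓ], E'[ℓ])` of `Gal(K̄/K)`-equivariant homomorphisms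
`E(K̄)[ℓ] → E'(K̄)[ℓ]`; for a prime `ℓ` this is an `𝔽_ℓ`-vector space, so if it contains a non-zero
element its exponent is `ℓ`, and Thm. 1.5 (1) gives `ℓ² ∣ d`, hence `ℓ² ≤ d`. Next
`d ≤ Υ^{2n} ≤ Υ⁸` because `n = 2/rg End E + 2/rg End E' ≤ 4` and `Υ ≥ 1` (`Υ² ≤ d`, `d ≥ 1`), and
Thm. 1.8, whose right-hand side is increasing in `n ≥ 1`, gives with `n ≤ 4`, `dim C = 2` and the
additivity `h_F(E × E') = h_F(E) + h_F(E')` of the stable height (Gaudron–Rémond 2014 §2.3, the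
field `FaltingsHeightTheory.hF_prod` of the tree's interface):
`Υ ≤ 241 (4e)⁸ 4⁵ [K:ℚ] max(1, log [K:ℚ], h_F(E) + h_F(E') + 3) =: B(E, E')`. Altogether
`ℓ² ≤ B(E, E')⁸`. This is the statement vendored below, over REAL definitions only:
`WeierstrassCurve.stableFaltingsHeight` (file `FaltingsHeight`), `WeierstrassCurve.geomTorsion`
with its `Gal(K̄/K)`-action (`GaloisAction`), `WeierstrassCurve.IsIsogenous` (`Isogeny`).

## Why not the general statements

Thms. 1.3–1.9 in general quantify over the class `𝒞`, `𝒞₀,#` (Tate modules free over `End ⊗ ℤ_ℓ`),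
`disc(End A)`, `vol(End A)`, `Υ`, `e(A)` and — in §1.5 — over the stable Faltings height of an
arbitrary abelian variety, which the tree only has as the hypothesis structure
`FaltingsHeightTheory` whose docstring warns that `∀ T : FaltingsHeightTheory, …`-statements are
NOT faithful for bounds increasing in the height (a `T` may undercut `h_F` on a non-elliptic isogeny
class); for elliptic curves `h_F` is a real definition, so the `E × E'` case is stated exactly.
Thm. 1.9 (1), (4) for general `A` are therefore not vendored here (they wait for a genuine
`h_F` on `AbelianVariety`); the conductor form wanted by `PolyFreyMazurPairs` additionally needs
`h_F(E) ≪ N_E log N_E` (Murty–Pasten 2013 / Pasten–Shimura 2024) and is the route's own theorem,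
not a Gaudron–Rémond fact (as the previous holder of the item noted).

## References

* [GaudronRemond2023] É. Gaudron, G. Rémond, *Nouveaux théorèmes d'isogénie*, Mém. Soc. Math.
  France 176 (2023): §1.2 (pp. 10–11: `𝒞`, `n`, Notations 1.1–1.2, `Υ² ≤ d ≤ Υ^{2n}`), Thm. 1.5 (1)
  (p. 13), Thm. 1.8 (p. 15), Ch. 16 Thm. 16.1 (proof of Thm. 1.8).
* [GaudronRemondPeriodes2014] É. Gaudron, G. Rémond, *Théorème des périodes et degrés minimaux
  d'isogénies*, Comment. Math. Helv. 89 (2014), §2.3 (additivity and normalisations of `h_F`).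
* D. Masser, G. Wüstholz, Bull. LMS 25 (1993) 247–254 (the `d = 1` mechanism, qualitative).
-/

noncomputable section

namespace Literature.NumberTheory.DiophantineGeometry

open WeierstrassCurve

/-- The Gaudron–Rémond bound `B(E, E') = 241 · (4e)⁸ · 4⁵ · [K:ℚ] · max(1, log [K:ℚ], h_F(E) + h_F(E') + 3)`
for `Υ` of the class generated by `E × E'` (Thm. 1.8 with `n ≤ 4`, `dim C = 2`,
`h_F(E × E') = h_F(E) + h_F(E')`; module docstring). [cite: GaudronRemond2023, Thm. 1.8] -/
def grPairBound (K : Type) [Field K] [NumberField K] (W W' : WeierstrassCurve K) [W.IsElliptic]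
    [W'.IsElliptic] : ℝ :=
  241 * (4 * Real.exp 1) ^ 8 * 4 ^ 5 * Module.finrank ℚ K *
    max 1 (max (Real.log (Module.finrank ℚ K)) (W.stableFaltingsHeight + W'.stableFaltingsHeight + 3))

/-- **Gaudron–Rémond 2023, Thm. 1.5 (1) + Thm. 1.8 at `C = E × E'` (named fact).** For elliptic
curves `E`, `E'` over a number field `K` which are not isogenous over `K` and a prime `ℓ`: if there
is a NON-ZERO `Gal(K̄/K)`-equivariant homomorphism `E(K̄)[ℓ] → E'(K̄)[ℓ]`, then
`ℓ² ≤ B(E, E')⁸`, `B(E, E') = grPairBound K W W'` — i.e. `ℓ² ∣ d ≤ Υ^{2n} ≤ Υ⁸` with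
`Υ ≤ 241 (4e)⁸ 4⁵ [K:ℚ] max(1, log[K:ℚ], h_F(E) + h_F(E') + 3)` (derivation in the module docstring;
the printed theorems are stated for the whole class `𝒞`, this is their instance `A = E`,
`B = E'`, `m = ℓ`, `Hom(E, E') = 0`). [cite: GaudronRemond2023, Thm. 1.5 (1) and Thm. 1.8 (with §1.2, Υ² ≤ d ≤ Υ^{2n})] -/
def GaudronRemond2023_torsionHom_ellipticPair : Prop :=
  ∀ (K : Type) [Field K] [NumberField K] (W W' : WeierstrassCurve K) [W.IsElliptic] [W'.IsElliptic],
    ¬ W.IsIsogenous W' →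
      ∀ ℓ : ℕ, ℓ.Prime →
        (∃ f : W.geomTorsion ℓ →+ W'.geomTorsion ℓ, f ≠ 0 ∧
            ∀ (σ : Field.absoluteGaloisGroup K) (P : W.geomTorsion ℓ), f (σ • P) = σ • f P) →
          (ℓ : ℝ) ^ 2 ≤ grPairBound K W W' ^ 8

namespace GaudronRemond2023_torsionHom_ellipticPair

variable {K : Type} [Field K] [NumberField K] {W W' : WeierstrassCurve K} [W.IsElliptic]
  [W'.IsElliptic]

/-- The bound `B(E, E')` is at least `241 · (4e)⁸ · 4⁵ ≥ 1` (in particular positive).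
[cite: GaudronRemond2023, Thm. 1.8] -/
theorem one_le_grPairBound : 1 ≤ grPairBound K W W' := by
  unfold grPairBound
  have hK : (1 : ℝ) ≤ Module.finrank ℚ K := by exact_mod_cast Module.finrank_pos
  have hmax : (1 : ℝ) ≤ max 1 (max (Real.log (Module.finrank ℚ K))
      (W.stableFaltingsHeight + W'.stableFaltingsHeight + 3)) := le_max_left _ _
  have he : (1 : ℝ) ≤ 4 * Real.exp 1 := by
    have := Real.add_one_le_exp (1 : ℝ)
    linarith
  calc (1 : ℝ) = 1 * 1 ^ 8 * 1 * 1 * 1 := by norm_num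
    _ ≤ 241 * (4 * Real.exp 1) ^ 8 * 4 ^ 5 * Module.finrank ℚ K *
        max 1 (max (Real.log (Module.finrank ℚ K))
          (W.stableFaltingsHeight + W'.stableFaltingsHeight + 3)) := by
      gcongr <;> norm_num

/-- **Linear form `ℓ ≤ B(E, E')⁴`** (square roots of `ℓ² ≤ B⁸`).
[cite: GaudronRemond2023, Thm. 1.5 (1) and Thm. 1.8] -/
theorem prime_le_pow_four (h : GaudronRemond2023_torsionHom_ellipticPair)
    (hW : ¬ W.IsIsogenous W') {ℓ : ℕ} (hℓ : ℓ.Prime)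
    (hf : ∃ f : W.geomTorsion ℓ →+ W'.geomTorsion ℓ, f ≠ 0 ∧
      ∀ (σ : Field.absoluteGaloisGroup K) (P : W.geomTorsion ℓ), f (σ • P) = σ • f P) :
    (ℓ : ℝ) ≤ grPairBound K W W' ^ 4 := by
  have h2 : (ℓ : ℝ) ^ 2 ≤ (grPairBound K W W' ^ 4) ^ 2 := by
    rw [← pow_mul]
    exact h K W W' hW ℓ hℓ hf
  have hB : 0 ≤ grPairBound K W W' ^ 4 :=
    pow_nonneg (zero_le_one.trans one_le_grPairBound) 4
  exact (pow_le_pow_iff_left₀ (Nat.cast_nonneg ℓ) hB two_ne_zero).1 h2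

/-- **Torsion-sharing form** (the hypothesis shape of route item `PolyFreyMazurPairs`): a
`Gal(K̄/K)`-equivariant ISOMORPHISM `E[ℓ] ≅ E'[ℓ]` between non-isogenous curves forces
`ℓ ≤ B(E, E')⁴`, granted a non-zero point of `E[ℓ]` (always available: `#E[ℓ] = ℓ²`, the tree's
`card_torsionPoints_eq_sq_holds`), which makes the isomorphism a non-zero homomorphism.
[cite: GaudronRemond2023, Thm. 1.5 (1) and Thm. 1.8] -/
theorem prime_le_of_equivariant_addEquiv (h : GaudronRemond2023_torsionHom_ellipticPair)
    (hW : ¬ W.IsIsogenous W') {ℓ : ℕ} (hℓ : ℓ.Prime) (hE : ∃ P : W.geomTorsion ℓ, P ≠ 0)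
    (e : W.geomTorsion ℓ ≃+ W'.geomTorsion ℓ)
    (he : ∀ (σ : Field.absoluteGaloisGroup K) (P : W.geomTorsion ℓ), e (σ • P) = σ • e P) :
    (ℓ : ℝ) ≤ grPairBound K W W' ^ 4 := by
  refine h.prime_le_pow_four hW hℓ ⟨e.toAddMonoidHom, fun h0 ↦ ?_, fun σ P ↦ he σ P⟩
  obtain ⟨P, hP⟩ := hE
  have : e P = 0 := by simpa using DFunLike.congr_fun h0 P
  exact hP (e.injective (this.trans (map_zero e).symm))

end GaudronRemond2023_torsionHom_ellipticPair

end Literature.NumberTheory.DiophantineGeometry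

end
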